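import Summits.BirchSwinnertonDyer.BirchSwinnertonDyer.Theorems.EdixhovenFibreFiveSevenTwistDegreeStepFiveSeven
import Summits.BirchSwinnertonDyer.BirchSwinnertonDyer.Theorems.EdixhovenFibreFiveSevenTwistDegreeStepFiveSevenTorsTwist
import Summits.BirchSwinnertonDyer.Rank1Residual.Additive.TypeGRamification
import HarnessLib

/-!
# Route `EdixhovenFibreFiveSeven`, KP57 split glue (stmt-BirchSwinnertonDyer-24320):
# `KPResidueOfCornerLow` — CORNER → LOW → KPTransportInputs → KPResidueManinUnitFiveSeven, PROVED

Cell `pub/bsd-wall` (D-0145 line `route-BirchSwinnertonDyer-EdixhovenFibreFiveSeven`, rev 3), seat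
`bsd-line-edix-p5` (prover, width-5 attach). THEOREMS ONLY (no definition, no named fact, no `sorry`). The item
is the GLUE of the planner's gen-1 split of the crux KP57 `KPResidueManinUnitFiveSeven` (stmt-BirchSwinnertonDyer-23810)
into the Kummer corner CORNER `KummerCornerTorsionOptimalManinUnit` (23883: `(p, ord_p Δ_min) ∈ {(5,3),(7,2)}`,
`(G)`-ordinary, a `ℚ_p`-rational point of order `p` ON the optimal curve), the non-ordinary cell LOW
`SupersingularTorsionOptimalManinUnitFive` (23884: `(p, ord_p Δ_min) ∈ {(5,2),(5,3),(7,2)}`, NOT `(G)`-ordinary)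
and the Literature bundle `KPTransportInputs` (24319: modularity `exists_isNewformOf` ∧ Dokchitser–Dokchitser
invariance of `ord_p Δ_min`). BSD is not proved by this file, and the children CORNER / LOW stay open.

Proof of `kpResidueOfCornerLow_proof` (tree lemmas only; the "one genuine step" of the item text — moving the
`ℚ_p`-rational `p`-torsion point from the witness `W′` to the optimal curve — is the sibling seat's
`TorsTwist.exists_prime_smul_eq_zero_of_isIsogenous`, p588615):
1. the `X₀(N)`-optimal member `V₀ ∼ V` with its lattice-optimal conductor-level datum `D₀` and
   `N(V₀) = N(V)` (`X12.exists_isIsogenous_optimal`, from `exists_isNewformOf`);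
2. transport to `V₀` of additivity (`X2.addv_iff_of_isIsogenous`), irreducibility (`X12.irr_iff_of_isIsogenous`),
   "no `Iₙ*` fibre" (`MemberManinUnitFiveSevenGlue.forall_ne_Istar_of_isIsogenous`), hence `0 ≤ ord_p j(V₀)`
   (`padicValRat_j_nonneg_of_forall_ne_Istar`);
3. the `p`-torsion point moves to `V₀` along a cyclic `ℚ`-isogeny of degree prime to `p`
   (`TorsTwist.exists_prime_smul_eq_zero_of_isIsogenous`: `X11b.not_dvd_degree_of_isCyclic_of_irr` +
   `Isogeny.exists_pointHom_baseChange_eq`, injective on `p`-torsion);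
4. `(p, ord_p Δ_min(V₀)) ∈ {(5,2),(5,3),(7,2)}` (`TwistDegreeStepFiveSeven.kp_types_of_torsion_witness`, Mazur's
   Step-1 residues + Dokchitser–Dokchitser);
5. split on `TypeGOrd V₀ p`: in the ordinary case `(5, 2)` is impossible — Kodaira II at `5` has semistability
   defect `e = 12 / gcd(12, 2) = 6 ∤ 5 − 1` whereas `(G)` forces `e ∣ p − 1`
   (`typeG_iff_not_subM_and_semistabilityIndex_dvd`) — so CORNER applies; otherwise LOW applies;
6. `p ∤ c(D₀)` is carried back to `V` by prime-to-`p` transport of the datum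
   (`ManinFrameTransport.exists_modularParametrizationData_not_dvd_of_partner`) at the common level `N(V)`.
The KP57 hypotheses "all degrees divisible by `p`" and "`N > 5·10⁵`" are idle in the glue.

References: [Mazur1977] Ch. III §5 Step 1; [DokchitserDokchitser2015LocalInvariants] Thm. 5.1 (1);
[SilvermanAEC2009] III.4, VII.3; [EdixhovenManin1991] §4; [KostersPannekoek2017] Thm. 1, Cor. 2.
-/

set_option autoImplicit false
-- the Theorems directory repeats the summit name (sibling precedent `SignedBaseChangeAssembly.lean`)
set_option linter.dupNamespace false

noncomputable section

open scoped Classical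

open WeierstrassCurve NumberField Literature.NumberTheory.EllipticCurves
  Literature.NumberTheory.EllipticCurves.ModularForms
  Literature.NumberTheory.EllipticCurves.Rank1Residual
  Literature.NumberTheory.DiophantineGeometry IsDedekindDomain Rat.HeightOneSpectrum
  Summit.BirchSwinnertonDyer.Rank1Residual Summit.BirchSwinnertonDyer.Rank1Residual.Additive
  Summit.BirchSwinnertonDyer.BirchSwinnertonDyer.Theorems
  Summit.BirchSwinnertonDyer.BirchSwinnertonDyer.Theses.EdixhovenFibreFiveSeven

namespace Summit.BirchSwinnertonDyer.BirchSwinnertonDyer.Theorems.KPResidueOfCornerLow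

/-- Re-indexing a datum along an equality of levels. [folklore] -/
private theorem exists_datum_not_dvd_of_level_eq {W : WeierstrassCurve ℚ} {N M : ℕ} [NeZero N]
    [NeZero M] (h : N = M) {p : ℕ} (D : ModularParametrizationData W N) (hc : ¬ (p : ℤ) ∣ D.c) :
    ∃ D' : ModularParametrizationData W M, ¬ (p : ℤ) ∣ D'.c := by
  subst h
  exact ⟨D, hc⟩

/-- **Kodaira II at `5` is not `(G)`-ordinary**: for a globally minimal `W` with `ord_5 Δ_min = 2` the
semistability defect is `e = 12 / gcd(12, 2) = 6 ∤ 4 = 5 − 1`, whereas hypothesis `(G)` (good reduction over a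
subfield of `ℚ(ζ_5)`) forces `e ∣ p − 1` (tree `typeG_iff_not_subM_and_semistabilityIndex_dvd`).
[cite: DokchitserDokchitser2015LocalInvariants, Thm. 5.1 (1)] -/
theorem not_typeGOrd_of_padicValInt_eq_two_five (W : WeierstrassCurve ℚ) [W.IsElliptic]
    [W.IsGloballyMinimal] [Fact (5 : ℕ).Prime] (h2 : padicValInt 5 W.minimalDiscriminantInt = 2) :
    ¬ TypeGOrd W 5 := by
  intro hG
  have hdvd : semistabilityIndex W 5 ∣ 5 - 1 :=
    ((typeG_iff_not_subM_and_semistabilityIndex_dvd W 5 (le_refl 5)).mp hG.typeG).2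
  rw [semistabilityIndex, h2] at hdvd
  exact absurd hdvd (by decide)

/-- **KP57 split glue `KPResidueOfCornerLow` (stmt-BirchSwinnertonDyer-24320), PROVED**: CORNER (23883) →
LOW (23884) → KPTransportInputs (24319) → `KPResidueManinUnitFiveSeven` (23810). See the module docstring for
the six steps; the torsion point is moved to the optimal curve by `TorsTwist.exists_prime_smul_eq_zero_of_isIsogenous`,
the Kodaira cell of the optimal curve is read off `TwistDegreeStepFiveSeven.kp_types_of_torsion_witness`, the
case `(5, II) ∧ (G)-ordinary` is void (`not_typeGOrd_of_padicValInt_eq_two_five`), and `p ∤ c` returns to `V` by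
`ManinFrameTransport.exists_modularParametrizationData_not_dvd_of_partner`.
[cite: Mazur1977, Ch. III §5, Step 1, p. 158] [cite: DokchitserDokchitser2015LocalInvariants, Thm. 5.1 (1)]
[cite: SilvermanAEC2009, Cor. III.4.9 and Cor. III.6.4(b)] -/
theorem kpResidueOfCornerLow_proof : KPResidueOfCornerLow := by
  intro hC hL hT p _ V _ _ _ hp57 hadd hirr hK hV4 hW' _ _
  obtain ⟨hnf, hDD⟩ := hT
  have hp : p.Prime := Fact.out
  have hp5 : 5 ≤ p := by omega
  have hp2 : p ≠ 2 := by omega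
  obtain ⟨W', hE', hM', P, hisoW', hP0, hP⟩ := hW'
  -- (1) the optimal member of the class of `V`
  obtain ⟨V₀, hE₀, hM₀, hNz₀, D₀, hiso, hN₀, hopt₀⟩ := X12.exists_isIsogenous_optimal hnf V
  haveI := hE₀
  haveI := hM₀
  haveI := hNz₀
  -- (2) transport of the local hypotheses
  have hirr₀ : Irr V₀ p := (X12.irr_iff_of_isIsogenous hiso p).mp hirr
  have hadd₀ : Addv V₀ p := (X2.addv_iff_of_isIsogenous (p := p) hiso).mp hadd
  have hK₀ : ∀ (v : HeightOneSpectrum ℤ) (n : ℕ), natGenerator v = p →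
      V₀.kodairaSymbolAt v ≠ KodairaSymbol.Istar n :=
    MemberManinUnitFiveSevenGlue.forall_ne_Istar_of_isIsogenous hiso hp2 hK
  have hj₀ : 0 ≤ padicValRat p V₀.j :=
    MemberManinUnitFiveSevenGlue.padicValRat_j_nonneg_of_forall_ne_Istar V₀ hp2 hadd₀ hK₀
  -- (3) the `ℚ_p`-rational point of order `p` moves to `V₀`
  have hisoVW : IsIsogenous V₀ W' := (hiso.symm_of_charZero).trans' hisoW'
  have hP' : (p : ℤ) • P = 0 := by rw [natCast_zsmul]; exact hP
  obtain ⟨Q, hQ0, hQ⟩ := TorsTwist.exists_prime_smul_eq_zero_of_isIsogenous hirr₀ hisoVW hP0 hP'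
  have hQ' : p • Q = 0 := by rw [← natCast_zsmul]; exact hQ
  -- (4) the Kodaira cell of `V₀`
  have htypes := TwistDegreeStepFiveSeven.kp_types_of_torsion_witness hDD V₀ hp5 hadd₀ hirr₀ hj₀ hisoVW hP0 hP
  -- (5) CORNER or LOW at the optimal curve
  have hc₀ : ¬ (p : ℤ) ∣ D₀.c := by
    by_cases hG : TypeGOrd V₀ p
    · refine hC V₀ p D₀ ?_ hadd₀ hirr₀ hG ⟨Q, hQ', hQ0⟩ hopt₀
      rcases htypes with ⟨h5, h2 | h3⟩ | h7
      · exfalso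
        subst h5
        exact not_typeGOrd_of_padicValInt_eq_two_five V₀ h2 hG
      · exact Or.inl ⟨h5, h3⟩
      · exact Or.inr h7
    · exact hL V₀ p D₀ htypes hadd₀ hirr₀ hG ⟨Q, hQ', hQ0⟩ hopt₀
  -- (6) back to `V` by prime-to-`p` transport, at the common conductor level
  obtain ⟨D, hc⟩ :=
    ManinFrameTransport.exists_modularParametrizationData_not_dvd_of_partner V hp hirr hiso D₀ hc₀
  exact exists_datum_not_dvd_of_level_eq hN₀ D hc

end Summit.BirchSwinnertonDyer.BirchSwinnertonDyer.Theorems.KPResidueOfCornerLow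

end
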